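import Summits.BirchSwinnertonDyer.BirchSwinnertonDyer.Theorems.Rank2Observatory2DescClSubCurveCertSDefs
import Summits.BirchSwinnertonDyer.BirchSwinnertonDyer.Theorems.Rank2Observatory2DescClKillCurveCertSVDefs
import HarnessLib

/-!
# BirchSwinnertonDyer — rank ≥ 2 observatory: KERNEL-2DESC-CL v3.1 SKSV — the SPLIT-2 kill-list / subgroup-sieve certificate (complex case) with the kill list in VALIDITY form, part 1/3: the checker

HONEST FRAMING: per-curve certified theorems and census instruments; no claim on BSD in rank ≥ 2.

Part 1 of 3.  `checkSKSV F cc r ks sv` = the v3.0ks checker `checkSKS` (`Rank2Observatory2DescClSubCurveCertSDefs`, whose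
`survClsS` / `liveSKS` are REUSED) clause for clause, with the light kill clause `ClKillS.liteV`
(`Rank2Observatory2DescClKillCurveCertSVDefs`: `z ≠ 0`, class non-trivial — NO prime list) in place of `ClKillS.lite`.
The kills themselves are the PROPOSITION `KillValidS F cc ks` (every kill prime is prime and its class is
`TwoDescKill.KillValidAt`-insoluble there — residue tree `killValidAt_of_killCheck` at ANY prime and fuel, linear
depth-2 `killValidAt_of_l2Check`, …), a hypothesis of the soundness theorem (part 2).
Text = the SKS file by `generics/v31/tools/mk_sksv.py`.  New declarations only; sorry-free; axioms `propext`,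
`Classical.choice`, `Quot.sound`.
[cite: Cassels1991LecturesEllipticCurves, §15] [cite: CremonaAlgorithms1997, §3.6]
-/

set_option linter.dupNamespace false

noncomputable section

open scoped Classical NumberField nonZeroDivisors

open Literature.NumberTheory.NumberFields Polynomial Module NumberField IsDedekindDomain Ideal

namespace Summit.BirchSwinnertonDyer.BirchSwinnertonDyer.Rank2Observatory.TwoDescCl

open TwoDescCubic ClFieldCert TwoDescKill

section Checkers

variable (F : ClFieldCertS2) (cc : ClCurveCertS)

/-- **The split-2 per-curve `r`-checker with a kill list and the SUBGROUP SIEVE, validity form**: the clauses of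
`checkSK F cc r ks` except its count, verbatim, the kill clause being `liteV` (no prime list); then: every class passing `admSK` is listed in `sv` (`2^n` sieve evaluations, as the old
count), and the subgroup-sieve search `noSubB` of depth `r + 1` over the live classes — pure list arithmetic — succeeds.
Computable; run by `decide +kernel`. [cite: Cassels1991LecturesEllipticCurves, §15] [cite: CremonaAlgorithms1997, §3.6] -/
def checkSKSV (r : ℕ) (ks : List ClKillS) (sv : List (List ℕ)) : Bool :=
  decide (deltaShort cc.A cc.B cc.C ≠ 0) &&
    noRootMod cc.pF cc.A cc.B cc.C &&
    decide (cubicAtCoords F.fs.base.a F.fs.base.b F.fs.base.c ((F.m₁ : ℤ) * cc.A) ((F.m₁ : ℤ) ^ 2 * cc.B)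
      ((F.m₁ : ℤ) ^ 3 * cc.C) cc.Xt = (0, 0, 0)) &&
    decide (derivAtCoords F.fs.base.a F.fs.base.b F.fs.base.c ((F.m₁ : ℤ) * cc.A) ((F.m₁ : ℤ) ^ 2 * cc.B) cc.Xt =
      MonicCubic.mulCoords F.fs.base.a F.fs.base.b F.fs.base.c (smulCoords (F.m₁ : ℤ) cc.XD)
        (prodPowCoords F.fs.base.a F.fs.base.b F.fs.base.c [])) &&
    (fracOf F cc.Xt cc.tsnT).check F.fs.base.a F.fs.base.b F.fs.base.c &&
    (fracOf F cc.XD cc.tsnD).check F.fs.base.a F.fs.base.b F.fs.base.c &&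
    decide (MonicCubic.disc cc.A cc.B cc.C < 0) &&
    decide (normFormZ F.fs.base.a F.fs.base.b F.fs.base.c cc.XD.1 cc.XD.2.1 cc.XD.2.2 ≠ 0) &&
    decide ((normFormZ F.fs.base.a F.fs.base.b F.fs.base.c cc.XD.1 cc.XD.2.1 cc.XD.2.2).natAbs =
      (cc.dn.map fun pe => pe.1 ^ pe.2).prod) &&
    (cc.dn.all fun pe => primeDispatchS F cc (fracOf F cc.XD cc.tsnD) cc.XD cc.dinvA cc.dmiss2 pe.1) &&
    (cc.codes.all fun bc => codeClauseS F cc bc) &&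
    invCert F.fs.base.a F.fs.base.b F.fs.base.c F.fs.base.w₁ cc.XD cc.dW1 &&
    invCert F.fs.base.a F.fs.base.b F.fs.base.c F.fs.base.w₂ cc.XD cc.dW2 &&
    (cc.Q.all fun q => decide (0 < q)) &&
    decide (cc.head.length = 4) &&
    ((famS cc).all fun f => famCheckS F cc f) &&
    decide (∀ T : Finset (Fin (famS cc).length), T ≠ ∅ →
      ∃ k : Fin (F.fs.base.chars.length + 3), Odd (T.filter fun j => bitS F cc k j = true).card) &&
    (ks.all fun k => k.liteV F cc) &&
    decide (∀ U : Finset (Fin (famS cc).length), admSK F cc ks ∅ U = true → U ∈ sv.map (survClsS cc)) &&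
    noSubB (fun U => decide (U ∈ liveSKS F cc ks sv)) (liveSKS F cc ks sv) (r + 1) [∅]

end Checkers

end Summit.BirchSwinnertonDyer.BirchSwinnertonDyer.Rank2Observatory.TwoDescCl

end
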